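import Literature.NumberTheory.LFunctions.WeilTwoPrimeDeflM72YBase
import Literature.NumberTheory.LFunctions.WeilBlockRowsFast
import HarnessLib

/-!
# Deflated two-prime certificate M72Y: the odd Bessel block claim `Hp = C H Cᵀ`, rows 25–29 (fast linear-traversal check)

The rows are checked with `WeilCert.checkHpRowT` (linear traversals, triangular storage of `weilCert23HC`) instead of the
indexed `checkHpRow` decide.  Pure proof file.
-/

noncomputable section

namespace Literature.NumberTheory.LFunctions

set_option maxHeartbeats 0 in
/-- Fast kernel check of claim row 25 of `Hp = C H Cᵀ` (odd block, certificate M72Y; triangular `C`). [folklore] -/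
theorem checkHpRowT1_25_weilCertDeflM72Y : weilCertDeflM72YBase.checkHpRowT weilCertDeflM72YHpO 1 25 = true := by
  decide +kernel

/-- Claim row 25 of `Hp = C H Cᵀ` (odd block, certificate M72Y), from the fast check. [folklore] -/
theorem checkHpRow1_25_weilCertDeflM72Y : weilCertDeflM72YBase.checkHpRow weilCertDeflM72YHpO 1 25 = true :=
  WeilCert.checkHpRow_of_T checkHpRowT1_25_weilCertDeflM72Y

set_option maxHeartbeats 0 in
/-- Fast kernel check of claim row 26 of `Hp = C H Cᵀ` (odd block, certificate M72Y; triangular `C`). [folklore] -/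
theorem checkHpRowT1_26_weilCertDeflM72Y : weilCertDeflM72YBase.checkHpRowT weilCertDeflM72YHpO 1 26 = true := by
  decide +kernel

/-- Claim row 26 of `Hp = C H Cᵀ` (odd block, certificate M72Y), from the fast check. [folklore] -/
theorem checkHpRow1_26_weilCertDeflM72Y : weilCertDeflM72YBase.checkHpRow weilCertDeflM72YHpO 1 26 = true :=
  WeilCert.checkHpRow_of_T checkHpRowT1_26_weilCertDeflM72Y

set_option maxHeartbeats 0 in
/-- Fast kernel check of claim row 27 of `Hp = C H Cᵀ` (odd block, certificate M72Y; triangular `C`). [folklore] -/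
theorem checkHpRowT1_27_weilCertDeflM72Y : weilCertDeflM72YBase.checkHpRowT weilCertDeflM72YHpO 1 27 = true := by
  decide +kernel

/-- Claim row 27 of `Hp = C H Cᵀ` (odd block, certificate M72Y), from the fast check. [folklore] -/
theorem checkHpRow1_27_weilCertDeflM72Y : weilCertDeflM72YBase.checkHpRow weilCertDeflM72YHpO 1 27 = true :=
  WeilCert.checkHpRow_of_T checkHpRowT1_27_weilCertDeflM72Y

set_option maxHeartbeats 0 in
/-- Fast kernel check of claim row 28 of `Hp = C H Cᵀ` (odd block, certificate M72Y; triangular `C`). [folklore] -/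
theorem checkHpRowT1_28_weilCertDeflM72Y : weilCertDeflM72YBase.checkHpRowT weilCertDeflM72YHpO 1 28 = true := by
  decide +kernel

/-- Claim row 28 of `Hp = C H Cᵀ` (odd block, certificate M72Y), from the fast check. [folklore] -/
theorem checkHpRow1_28_weilCertDeflM72Y : weilCertDeflM72YBase.checkHpRow weilCertDeflM72YHpO 1 28 = true :=
  WeilCert.checkHpRow_of_T checkHpRowT1_28_weilCertDeflM72Y

set_option maxHeartbeats 0 in
/-- Fast kernel check of claim row 29 of `Hp = C H Cᵀ` (odd block, certificate M72Y; triangular `C`). [folklore] -/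
theorem checkHpRowT1_29_weilCertDeflM72Y : weilCertDeflM72YBase.checkHpRowT weilCertDeflM72YHpO 1 29 = true := by
  decide +kernel

/-- Claim row 29 of `Hp = C H Cᵀ` (odd block, certificate M72Y), from the fast check. [folklore] -/
theorem checkHpRow1_29_weilCertDeflM72Y : weilCertDeflM72YBase.checkHpRow weilCertDeflM72YHpO 1 29 = true :=
  WeilCert.checkHpRow_of_T checkHpRowT1_29_weilCertDeflM72Y

end Literature.NumberTheory.LFunctions
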